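import Summits.BirchSwinnertonDyer.BirchSwinnertonDyer.Theorems.ManinLocalTwoThreeNeronFLineBookkeeping
import Mathlib.RingTheory.PrincipalIdealDomain
import HarnessLib

/-!
# Néron `f`-line bookkeeping WITHOUT `f ∈ Λ`: `|c| · s · r = m₀ · deg φ`, `m₀ = [ℤf : ℤf ∩ Λ]`

Cell bsd-f2-manin, prover seat p3 g17 (sequel to `…NeronFLineBookkeeping`, p743505).  Over the tree's posited datum
`Δ : NeronFLineDatum W D` let `T := {t ∈ ℤ : t•f ∈ Λ}` (an ideal of `ℤ`) and `m₀ := #(ℤ ⧸ T) = [ℤ f : ℤ f ∩ Λ]` (the order of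
`f` modulo `Λ`; `m₀ = 1 ⟺ f ∈ Λ`).  With `s = Δ.lieSaturationIndex`, `r = Δ.neronCongruenceNumber`, `c = D.maninConstant`, UNCONDITIONALLY over the interface:

* `natAbs_maninConstant_mul_lieSaturationIndex_mul_neronCongruenceNumber_eq`: **`|c| · s · r = m₀ · deg φ`** (`m₀ = 0`, `s·r = 0` if no non-zero
  multiple of `f` lies in `Λ`; for the true Néron lattice `c•f = π^*ω ∈ Λ`, so `m₀ ∣ c`), and `fLineOrder_dvd : n•f ∈ Λ → m₀ ∣ n`;
* `padicVal_bookkeeping_iff`-type consequence: **`v_p(c) + v_p(s) + v_p(r) = v_p(m₀) + v_p(deg φ)`**, so imc's PROP 29.AO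
  `v_p(c) + s_p + r^𝒩_p = v_p(deg φ)` holds IFF `p ∤ m₀`, i.e. iff `f ∈ Λ ⊗ ℤ₍ₚ₎` — the axiom `NeronFormalInvariants.ao` of imc's
  Hasse–Witt sketch carries this as a HIDDEN PREMISE (at `p = 2`, `4 ∣ N` it is the GIVEN-row input, not free); with `m₀ = |c|`
  (i.e. `Λ ∩ ℚf = ℤ·cf`) the identity law 𝕀 would be consistent with ANY `v₂(c)`.
* `depthAt_iff_padicValNat_eq_fLineOrder`: `NeronCongruenceDepthAt p ⟺ v_p(r) = v_p(m₀) + v_p(deg φ)`.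
Mechanism: for the generator `d` of `T`, the `f`-line kernel `ℤf + Λ ∩ f^⊥` is EXACTLY `{g : ξ^*(d f) ∣ ξ^*(g)}`, so the third-isomorphism
count of the parent file applies with `ξ^*(d f) · c = d · deg φ`.  Pure bookkeeping; BSD is not proved by this; Manin's conjecture is not proved.
-/

set_option autoImplicit false
set_option linter.dupNamespace false

namespace Summit.BirchSwinnertonDyer.BirchSwinnertonDyer.Theorems.ManinLocalTwoThree.NeronFLineBookkeeping

open scoped MatrixGroups ModularForm
open CongruenceSubgroup Literature.NumberTheory.EllipticCurves.ModularForms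
open Summit.BirchSwinnertonDyer.Rank1Residual.ManinAdditive

variable {N : ℕ} [NeZero N] {W : WeierstrassCurve ℚ} [W.IsElliptic] {D : ModularParametrizationData W N}
  (Δ : NeronFLineDatum W D)

/-- For the GENERATOR `d` of `T = {t : t•f ∈ Λ}`: the `f`-line kernel `ℤf + Λ ∩ f^⊥` lies in `{g : ξ^*(d f) ∣ ξ^*(g)}` (if `g = t f + h`
with `h ∈ Λ ∩ f^⊥` then `t ∈ T = dℤ` and `ξ^*(g) = (t/d)·ξ^*(d f)`). [folklore] -/
theorem fLine_le_ker_of_generator {d : ℤ} (hd : d • D.f ∈ Δ.Λ)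
    (hgen : ∀ t : ℤ, t • D.f ∈ Δ.Λ → d ∣ t) :
    ((ℤ ∙ D.f) ⊔ (Δ.Λ ⊓ (LinearMap.ker (peterssonProductₗ (Gamma0 N) 2 D.f)).restrictScalars ℤ)).comap
        Δ.Λ.subtype ≤
      LinearMap.ker ((Submodule.span ℤ {Δ.xiStar ⟨d • D.f, hd⟩}).mkQ ∘ₗ Δ.xiStar) := by
  intro g hg
  rw [Submodule.mem_comap, Submodule.subtype_apply, Submodule.mem_sup] at hg
  obtain ⟨y, hy, z, hz, hyz⟩ := hg
  obtain ⟨t, rfl⟩ := Submodule.mem_span_singleton.mp hy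
  obtain ⟨hzΛ, hzker⟩ := Submodule.mem_inf.mp hz
  rw [Submodule.restrictScalars_mem, LinearMap.mem_ker, peterssonProductₗ_apply] at hzker
  have hz0 : Δ.xiStar ⟨z, hzΛ⟩ = 0 := (xiStar_eq_zero_iff Δ ⟨z, hzΛ⟩).mpr hzker
  have htΛ : t • D.f ∈ Δ.Λ := by
    have : t • D.f = (g : CuspForm (Gamma0 N) 2) - z := eq_sub_of_add_eq hyz
    rw [this]
    exact Δ.Λ.sub_mem g.2 hzΛ
  obtain ⟨k, rfl⟩ := hgen t htΛ
  have e : g = k • ⟨d • D.f, hd⟩ + ⟨z, hzΛ⟩ := by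
    apply Subtype.ext
    simp [← hyz, mul_comm d k, mul_smul]
  rw [LinearMap.mem_ker, LinearMap.comp_apply, Submodule.mkQ_apply, Submodule.Quotient.mk_eq_zero,
    Submodule.mem_span_singleton]
  exact ⟨k, by rw [e, map_add, map_smul, hz0, add_zero]⟩

/-- **`|c| · s · r = m₀ · deg φ` with `m₀ = [ℤf : ℤf ∩ Λ] = #(ℤ ⧸ {t : t•f ∈ Λ})` — UNCONDITIONALLY over the interface** (with the
`Nat.card` conventions: if no non-zero multiple of `f` lies in `Λ` then `m₀ = 0` and `s · r = 0`).  `m₀ = 1` recovers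
`natAbs_maninConstant_mul_lieSaturationIndex_mul_neronCongruenceNumber`. [folklore] -/
theorem natAbs_maninConstant_mul_lieSaturationIndex_mul_neronCongruenceNumber_eq :
    D.maninConstant.natAbs * Δ.lieSaturationIndex * Δ.neronCongruenceNumber =
      Nat.card (ℤ ⧸ Δ.Λ.comap (LinearMap.toSpanSingleton ℤ (CuspForm (Gamma0 N) 2) D.f)) * D.modularDegree := by
  set T : Submodule ℤ ℤ := Δ.Λ.comap (LinearMap.toSpanSingleton ℤ (CuspForm (Gamma0 N) 2) D.f) with hT
  haveI : T.IsPrincipal := IsPrincipalIdealRing.principal T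
  set d : ℤ := Submodule.IsPrincipal.generator T with hdT
  have hmemT : ∀ t : ℤ, t ∈ T ↔ t • D.f ∈ Δ.Λ := fun t => by
    rw [hT, Submodule.mem_comap, LinearMap.toSpanSingleton_apply]
  have hspan : Submodule.span ℤ {d} = T := Ideal.span_singleton_generator T
  have hd : d • D.f ∈ Δ.Λ := (hmemT d).mp (Submodule.IsPrincipal.generator_mem T)
  have hgen : ∀ t : ℤ, t • D.f ∈ Δ.Λ → d ∣ t := fun t ht => by
    obtain ⟨k, hk⟩ := (Submodule.IsPrincipal.mem_iff_eq_smul_generator T).mp ((hmemT t).mpr ht)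
    exact ⟨k, by rw [hk, smul_eq_mul, mul_comm]⟩
  have hcardT : Nat.card (ℤ ⧸ T) = d.natAbs := by
    rw [Nat.card_congr (Submodule.quotEquivOfEq _ _ hspan.symm).toEquiv,
      Nat.card_congr (Int.quotientSpanEquivZMod d).toEquiv, Nat.card_zmod]
  -- the f-line kernel IS the kernel for the generator multiple
  have hker : LinearMap.ker ((Submodule.span ℤ {Δ.xiStar ⟨d • D.f, hd⟩}).mkQ ∘ₗ Δ.xiStar) =
      ((ℤ ∙ D.f) ⊔ (Δ.Λ ⊓ (LinearMap.ker (peterssonProductₗ (Gamma0 N) 2 D.f)).restrictScalars ℤ)).comap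
        Δ.Λ.subtype :=
    le_antisymm (ker_le_fLine Δ hd) (fLine_le_ker_of_generator Δ hd hgen)
  have h1 := lieSaturationIndex_mul_card_quotient_ker Δ hd
  rw [hker] at h1
  have h2 := xiStar_smul_self_mul_maninConstant Δ hd
  have h3 : (Δ.xiStar ⟨d • D.f, hd⟩).natAbs * D.maninConstant.natAbs = d.natAbs * D.modularDegree := by
    rw [← Int.natAbs_mul, h2, Int.natAbs_mul, Int.natAbs_natCast]
  rw [hcardT, mul_comm D.maninConstant.natAbs, mul_assoc, mul_comm D.maninConstant.natAbs, ← mul_assoc]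
  show Δ.lieSaturationIndex * Nat.card (Δ.Λ ⧸ _) * D.maninConstant.natAbs = _
  rw [h1, h3]

/-- `m₀ = [ℤf : ℤf ∩ Λ]` divides every `n` with `n•f ∈ Λ`. [folklore] -/
theorem fLineOrder_dvd {n : ℤ} (hn : n • D.f ∈ Δ.Λ) :
    Nat.card (ℤ ⧸ Δ.Λ.comap (LinearMap.toSpanSingleton ℤ (CuspForm (Gamma0 N) 2) D.f)) ∣ n.natAbs := by
  set T : Submodule ℤ ℤ := Δ.Λ.comap (LinearMap.toSpanSingleton ℤ (CuspForm (Gamma0 N) 2) D.f) with hT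
  haveI : T.IsPrincipal := IsPrincipalIdealRing.principal T
  have hspan : Submodule.span ℤ {Submodule.IsPrincipal.generator T} = T := Ideal.span_singleton_generator T
  have hnT : n ∈ T := by rw [hT, Submodule.mem_comap, LinearMap.toSpanSingleton_apply]; exact hn
  obtain ⟨k, hk⟩ := (Submodule.IsPrincipal.mem_iff_eq_smul_generator T).mp hnT
  rw [Nat.card_congr (Submodule.quotEquivOfEq _ _ hspan.symm).toEquiv,
    Nat.card_congr (Int.quotientSpanEquivZMod _).toEquiv, Nat.card_zmod]
  exact Int.natAbs_dvd_natAbs.mpr ⟨k, by rw [hk, smul_eq_mul, mul_comm]⟩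

/-- **PROP 29.AO with its defect term: `v_p(c) + v_p(s) + v_p(r) = v_p(m₀) + v_p(deg φ)`** (`m₀ = [ℤf : ℤf ∩ Λ]`), whenever some non-zero
multiple of `f` lies in `Λ`.  So the bookkeeping identity `v_p(c) + s_p + r^𝒩_p = v_p(deg φ)` holds EXACTLY WHEN `p ∤ m₀` (`f ∈ Λ ⊗ ℤ₍ₚ₎`). [folklore] -/
theorem padicVal_bookkeeping_eq {n : ℤ} (hn : n • D.f ∈ Δ.Λ) (hn0 : n ≠ 0) (p : ℕ) [hp : Fact p.Prime] :
    padicValInt p D.maninConstant + padicValNat p Δ.lieSaturationIndex + padicValNat p Δ.neronCongruenceNumber =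
      padicValNat p (Nat.card (ℤ ⧸ Δ.Λ.comap (LinearMap.toSpanSingleton ℤ (CuspForm (Gamma0 N) 2) D.f))) +
        padicValNat p D.modularDegree := by
  have h := natAbs_maninConstant_mul_lieSaturationIndex_mul_neronCongruenceNumber_eq Δ
  have hm := fLineOrder_dvd Δ hn
  set m₀ := Nat.card (ℤ ⧸ Δ.Λ.comap (LinearMap.toSpanSingleton ℤ (CuspForm (Gamma0 N) 2) D.f)) with hm₀
  have hdeg : D.modularDegree ≠ 0 := D.deg_pos.ne'
  have hm0 : m₀ ≠ 0 := fun h0 => by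
    rw [h0, zero_dvd_iff] at hm
    exact hn0 (Int.natAbs_eq_zero.mp hm)
  have hprod : D.maninConstant.natAbs * Δ.lieSaturationIndex * Δ.neronCongruenceNumber ≠ 0 :=
    h ▸ mul_ne_zero hm0 hdeg
  have hc : D.maninConstant.natAbs ≠ 0 := fun h0 => hprod (by rw [h0, zero_mul, zero_mul])
  have hs : Δ.lieSaturationIndex ≠ 0 := fun h0 => hprod (by rw [h0, mul_zero, zero_mul])
  have hr : Δ.neronCongruenceNumber ≠ 0 := fun h0 => hprod (by rw [h0, mul_zero])
  have hv := congrArg (padicValNat p) h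
  rw [padicValNat.mul (mul_ne_zero hc hs) hr, padicValNat.mul hc hs, padicValNat.mul hm0 hdeg] at hv
  rw [padicValInt]
  exact_mod_cast hv

/-- Corollary: if a PRIME-TO-`p` multiple of `f` lies in `Λ`, PROP 29.AO holds with EQUALITY at `p` (sharpening the parent file's
`padicVal_bookkeeping_le`). [folklore] -/
theorem padicVal_bookkeeping_of_coprime {n : ℤ} (hn : n • D.f ∈ Δ.Λ) (hn0 : n ≠ 0) (p : ℕ) [hp : Fact p.Prime]
    (hpn : ¬ (p : ℤ) ∣ n) :
    padicValInt p D.maninConstant + padicValNat p Δ.lieSaturationIndex + padicValNat p Δ.neronCongruenceNumber =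
      padicValNat p D.modularDegree := by
  have h := padicVal_bookkeeping_eq Δ hn hn0 p
  have hm := fLineOrder_dvd Δ hn
  have hm0 : padicValNat p (Nat.card (ℤ ⧸ Δ.Λ.comap (LinearMap.toSpanSingleton ℤ (CuspForm (Gamma0 N) 2) D.f))) = 0 := by
    rw [padicValNat.eq_zero_iff]
    right; right
    intro hd
    exact hpn (Int.natCast_dvd.mpr (dvd_trans hd hm))
  omega

/-- **Depth with the defect term**: whenever some non-zero multiple of `f` lies in `Λ`,
`NeronCongruenceDepthAt p ⟺ v_p(r) = v_p(m₀) + v_p(deg φ)` (tree COLLAPSE `depthAt_iff` + `lieSaturatedAt_iff_not_dvd` + the defect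
identity); imc's exponent `r^𝒩_p = v_p(r) − v_p(m₀)` reaches `v_p(deg φ)` exactly in the depth case. [folklore] -/
theorem depthAt_iff_padicValNat_eq_fLineOrder {n : ℤ} (hn : n • D.f ∈ Δ.Λ) (hn0 : n ≠ 0) (p : ℕ) [hp : Fact p.Prime] :
    Δ.NeronCongruenceDepthAt p ↔
      padicValNat p Δ.neronCongruenceNumber =
        padicValNat p (Nat.card (ℤ ⧸ Δ.Λ.comap (LinearMap.toSpanSingleton ℤ (CuspForm (Gamma0 N) 2) D.f))) +
          padicValNat p D.modularDegree := by
  have h := padicVal_bookkeeping_eq Δ hn hn0 p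
  have hprod := natAbs_maninConstant_mul_lieSaturationIndex_mul_neronCongruenceNumber_eq Δ
  have hm := fLineOrder_dvd Δ hn
  have hdeg : D.modularDegree ≠ 0 := D.deg_pos.ne'
  have hm0 : Nat.card (ℤ ⧸ Δ.Λ.comap (LinearMap.toSpanSingleton ℤ (CuspForm (Gamma0 N) 2) D.f)) ≠ 0 := fun h0 => by
    rw [h0, zero_dvd_iff] at hm
    exact hn0 (Int.natAbs_eq_zero.mp hm)
  have hne : D.maninConstant.natAbs * Δ.lieSaturationIndex * Δ.neronCongruenceNumber ≠ 0 :=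
    hprod ▸ mul_ne_zero hm0 hdeg
  have hc : D.maninConstant.natAbs ≠ 0 := fun h0 => hne (by rw [h0, zero_mul, zero_mul])
  have hs : Δ.lieSaturationIndex ≠ 0 := fun h0 => hne (by rw [h0, mul_zero, zero_mul])
  have hcv : padicValInt p D.maninConstant = 0 ↔ ¬ (p : ℤ) ∣ D.maninConstant := by
    rw [padicValInt, padicValNat.eq_zero_iff, Int.natCast_dvd]
    constructor
    · rintro (h1 | h0 | hnd)
      · exact absurd h1 hp.out.one_lt.ne'
      · exact absurd h0 hc
      · exact hnd
    · exact fun hnd => Or.inr (Or.inr hnd)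
  have hsv : padicValNat p Δ.lieSaturationIndex = 0 ↔ ¬ p ∣ Δ.lieSaturationIndex := by
    rw [padicValNat.eq_zero_iff]
    constructor
    · rintro (h1 | h0 | hnd)
      · exact absurd h1 hp.out.one_lt.ne'
      · exact absurd h0 hs
      · exact hnd
    · exact fun hnd => Or.inr (Or.inr hnd)
  rw [Δ.depthAt_iff, lieSaturatedAt_iff_not_dvd, ← hcv, ← hsv]
  have h0 : 0 ≤ padicValInt p D.maninConstant := by positivity
  omega

end Summit.BirchSwinnertonDyer.BirchSwinnertonDyer.Theorems.ManinLocalTwoThree.NeronFLineBookkeeping
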